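import Summits.RiemannHypothesis.RiemannHypothesis.Theorems.WeilGroundStateGroundStatesConvergeToXiStubDoobLongRange
import Summits.RiemannHypothesis.RiemannHypothesis.Theorems.WeilGroundStateGroundStatesConvergeToXiStubDoobKernelSign
import Summits.RiemannHypothesis.RiemannHypothesis.Theorems.WeilGroundStateGroundStatesConvergeToXiStubDoobPolar
import Summits.RiemannHypothesis.RiemannHypothesis.Theorems.WeilGroundStateGroundStatesConvergeToXiStubDoobPrime
import Summits.RiemannHypothesis.RiemannHypothesis.Theorems.WeilGroundStateGroundStatesConvergeToXiStubWeilGroundEnergyDoob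
import Summits.RiemannHypothesis.RiemannHypothesis.Theorems.GroundStatesConvergeToXi.Negative.NotAttained
import Literature.NumberTheory.LFunctions.WeilExplicit
import Mathlib.MeasureTheory.Integral.Prod
import HarnessLib

/-!
# `WeilGroundState.GroundStatesConvergeToXi` — bulk Poincaré inequality for the short-range Doob energy
(crux item stmt-RiemannHypothesis-1527, route route-RiemannHypothesis-WeilGroundState; line `Sketch`,
stub `stub_doob_bulkPoincare` (G3); `--supports`; RH-free; card `xi-kernel-doob-transform` F1)

Dictionary (inline, no definitions): `Φ(t) = 2Ψ(2t)` is Riemann's kernel (real form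
`2 * LagariasMontague.Psi (2 * t)`, continuous and `> 0`, `geDoob_Psi_pos`); for a test function
`w` the `Φ`-weighted jump energy at lag `h` is `I_w(h) = ∫ Φ(t) Φ(t+h) ‖w(t+h) − w(t)‖² dt ≥ 0`
and the signed archimedean–polar Lévy kernel is `J(h) = e^{h/2}/(2 sinh h) − 2 cosh(h/2)`.

For `tsupport w ⊆ [−R, R]`, `0 < R ≤ 1/8`, with `m_R = ∫_{[−R,R]} Φ`, `w̄ = (∫_{[−R,R]} Φ w)/m_R`:
`J(2R) · m_R · ∫_{[−R,R]} Φ ‖w − w̄‖² ≤ ∫_{(0,2R]} J(h) I_w(h) dh`.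

* STEP 1 (`doobBP_main`): on `(0, 2R]`, `J(h) ≥ J(2R) > 0` (`doobLR_partB`, `stub_doobKernel_sign`
  at `2R ≤ 1/4`) and `I_w ≥ 0`, so `∫_{(0,2R]} J I_w ≥ J(2R) ∫_{(0,2R]} I_w` (integrability of
  `J · I_w` there: `stub_doob_arch` minus twice `stub_doob_polar`).
* STEP 2 (`doobBP_square_le`): `I_w` is even (`doobBP_I_even`, substitution `t ↦ t + h`), so
  `2 ∫_{(0,2R]} I_w = ∫_{[−2R,2R]} I_w` (`doobBP_half`); the truncated integrand
  `1_{[−2R,2R]}(h) Φ(t)Φ(t+h)‖w(t+h) − w(t)‖²` is continuous of compact support on `ℝ²`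
  (`doobBP_prod_integrable`), so Fubini and the substitution `s = t + h` give
  `∫_{[−2R,2R]} I_w = ∫_t ∫_{s ∈ [t−2R, t+2R]} Φ(t)Φ(s)‖w(s) − w(t)‖² ≥ ∬_{[−R,R]²}` (nonnegative
  integrand, `[−R,R] ⊆ [t−2R,t+2R]` for `|t| ≤ R`).
* STEP 3 (`doobBP_variance`): the variance identity on the square,
  `∬_{[−R,R]²} Φ(t)Φ(s)‖w(s) − w(t)‖² = 2 m_R ∫_{[−R,R]} Φ‖w − w̄‖²` (polarisation around `w̄`,
  `doobBP_polar`, the cross term vanishing since `∫_{[−R,R]} Φ (w − w̄) = 0`).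

No new definitions; named facts used: `stub_doobKernel_sign`, `doobLR_partB`, `stub_doob_arch`,
`stub_doob_polar`, `geDoob_Psi_pos` (all landed).
-/

noncomputable section

set_option linter.dupNamespace false

open scoped Topology Real ComplexConjugate
open Filter Set MeasureTheory Complex

namespace Summit.RiemannHypothesis.RiemannHypothesis.Theorems.GroundStatesConvergeToXi

open Literature.NumberTheory.LFunctions

/-! ## Pointwise algebra and the jump energy -/

/-- Polarisation around a centre `c`: for real `a, b` and complex `p, q, c`,
`a b ‖p − q‖² = a (b ‖p − c‖²) + a ‖q − c‖² b − 2a · Re(b (p − c) · conj (q − c))`. [folklore] -/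
theorem doobBP_polar (c : ℂ) (a b : ℝ) (p q : ℂ) :
    a * b * ‖p - q‖ ^ 2 = a * (b * ‖p - c‖ ^ 2) + a * ‖q - c‖ ^ 2 * b -
      2 * a * ((b : ℂ) * (p - c) * conj (q - c)).re := by
  simp only [Complex.sq_norm, Complex.normSq_apply, Complex.sub_re, Complex.sub_im,
    Complex.mul_re, Complex.mul_im, Complex.ofReal_re, Complex.ofReal_im, Complex.conj_re,
    Complex.conj_im]
  ring

/-- The jump energy `I(h) = ∫ φ(t) φ(t+h) ‖w(t+h) − w(t)‖² dt` of a nonnegative weight is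
nonnegative. [folklore] -/
theorem doobBP_I_nonneg {φ : ℝ → ℝ} (hφ0 : ∀ t, 0 ≤ φ t) (w : ℝ → ℂ) (h : ℝ) :
    0 ≤ ∫ t : ℝ, φ t * φ (t + h) * ‖w (t + h) - w t‖ ^ 2 :=
  integral_nonneg fun _ => mul_nonneg (mul_nonneg (hφ0 _) (hφ0 _)) (sq_nonneg _)

/-- The jump energy is even in the lag: `I(−h) = I(h)` (substitute `t ↦ t + h`). [folklore] -/
theorem doobBP_I_even (φ : ℝ → ℝ) (w : ℝ → ℂ) (h : ℝ) :
    ∫ t : ℝ, φ t * φ (t + -h) * ‖w (t + -h) - w t‖ ^ 2 =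
      ∫ t : ℝ, φ t * φ (t + h) * ‖w (t + h) - w t‖ ^ 2 := by
  rw [← integral_add_right_eq_self (μ := volume)
    (fun t : ℝ => φ t * φ (t + -h) * ‖w (t + -h) - w t‖ ^ 2) h]
  refine integral_congr_ae (ae_of_all _ fun t => ?_)
  beta_reduce
  rw [add_neg_cancel_right, norm_sub_rev]
  ring

/-- For an even `I`, integrable on `[−a, a]`: `∫_{[−a,a]} I = 2 ∫_{(0,a]} I`. [folklore] -/
theorem doobBP_half {I : ℝ → ℝ} {a : ℝ} (ha : 0 ≤ a) (heven : ∀ h, I (-h) = I h)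
    (hI : IntegrableOn I (Icc (-a) a)) :
    ∫ h in Icc (-a) a, I h = 2 * ∫ h in Ioc 0 a, I h := by
  have h1 : IntervalIntegrable I volume (-a) 0 :=
    (intervalIntegrable_iff_integrableOn_Icc_of_le (by linarith)).2
      (hI.mono_set (Icc_subset_Icc le_rfl ha))
  have h2 : IntervalIntegrable I volume 0 a :=
    (intervalIntegrable_iff_integrableOn_Icc_of_le ha).2
      (hI.mono_set (Icc_subset_Icc (by linarith) le_rfl))
  have h3 : ∫ h in (0 : ℝ)..a, I (-h) = ∫ h in -a..-0, I h := intervalIntegral.integral_comp_neg I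
  simp only [heven, neg_zero] at h3
  rw [integral_Icc_eq_integral_Ioc, ← intervalIntegral.integral_of_le (neg_le_self ha),
    ← intervalIntegral.integral_add_adjacent_intervals h1 h2, ← h3,
    intervalIntegral.integral_of_le ha]
  ring

/-! ## Joint integrability of the truncated jump integrand -/

/-- For continuous `φ`, `w` with `tsupport w ⊆ [−R, R]`, the truncated jump integrand
`(h, t) ↦ 1_{[−2R,2R]}(h) φ(t) φ(t+h) ‖w(t+h) − w(t)‖²` is the restriction to the compact box
`[−2R,2R] × [−3R,3R]` of a continuous function, hence integrable on `ℝ × ℝ`. [folklore] -/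
theorem doobBP_prod_integrable {φ : ℝ → ℝ} (hφc : Continuous φ) {w : ℝ → ℂ} (hwc : Continuous w)
    {R : ℝ} (hR : 0 ≤ R) (hsupp : tsupport w ⊆ Icc (-R) R) :
    Integrable (fun z : ℝ × ℝ => (Icc (-(2 * R)) (2 * R)).indicator (fun _ => (1 : ℝ)) z.1 *
      (φ z.2 * φ (z.2 + z.1) * ‖w (z.2 + z.1) - w z.2‖ ^ 2))
      ((volume : Measure ℝ).prod volume) := by
  have hK : IsCompact (Icc (-(2 * R)) (2 * R) ×ˢ Icc (-(3 * R)) (3 * R)) :=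
    isCompact_Icc.prod isCompact_Icc
  have hG : Continuous fun z : ℝ × ℝ => φ z.2 * φ (z.2 + z.1) * ‖w (z.2 + z.1) - w z.2‖ ^ 2 := by
    fun_prop
  have hint : Integrable ((Icc (-(2 * R)) (2 * R) ×ˢ Icc (-(3 * R)) (3 * R)).indicator
      fun z : ℝ × ℝ => φ z.2 * φ (z.2 + z.1) * ‖w (z.2 + z.1) - w z.2‖ ^ 2)
      ((volume : Measure ℝ).prod volume) :=
    (integrable_indicator_iff (measurableSet_Icc.prod measurableSet_Icc)).2
      (hG.continuousOn.integrableOn_compact hK)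
  refine hint.congr (ae_of_all _ fun z => ?_)
  have hw0 : ∀ x, w x ≠ 0 → -R ≤ x ∧ x ≤ R := fun x hx => hsupp (subset_tsupport _ hx)
  simp only [Set.indicator_apply, Set.mem_prod, mem_Icc]
  by_cases hh : -(2 * R) ≤ z.1 ∧ z.1 ≤ 2 * R
  · by_cases ht : -(3 * R) ≤ z.2 ∧ z.2 ≤ 3 * R
    · rw [if_pos ⟨hh, ht⟩, if_pos hh, one_mul]
    · have h1 : w z.2 = 0 := by
        by_contra hne
        have := hw0 _ hne
        exact ht ⟨by linarith [this.1], by linarith [this.2]⟩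
      have h2 : w (z.2 + z.1) = 0 := by
        by_contra hne
        have := hw0 _ hne
        exact ht ⟨by linarith [this.1, hh.2], by linarith [this.2, hh.1]⟩
      rw [if_neg (fun h' => ht h'.2), if_pos hh, h1, h2, sub_zero, norm_zero]
      ring
  · rw [if_neg (fun h' => hh h'.1), if_neg hh, zero_mul]

/-! ## Step 2: the short-range bulk energy dominates the square -/

/-- **Bulk lower bound.** For a continuous weight `φ ≥ 0` and a continuous `w` with
`tsupport w ⊆ [−R, R]`:
`∬_{[−R,R]²} φ(t)φ(s)‖w(s) − w(t)‖² ds dt ≤ 2 ∫_{(0,2R]} I(h) dh`,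
`I(h) = ∫ φ(t)φ(t+h)‖w(t+h) − w(t)‖² dt` (evenness, Fubini for the truncated integrand, the
substitution `s = t + h`, and `[−R,R] ⊆ [t−2R, t+2R]` for `|t| ≤ R`). [folklore] -/
theorem doobBP_square_le {φ : ℝ → ℝ} (hφc : Continuous φ) (hφ0 : ∀ t, 0 ≤ φ t) {w : ℝ → ℂ}
    (hwc : Continuous w) {R : ℝ} (hR : 0 ≤ R) (hsupp : tsupport w ⊆ Icc (-R) R) :
    ∫ t in Icc (-R) R, ∫ s in Icc (-R) R, φ t * φ s * ‖w s - w t‖ ^ 2 ≤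
      2 * ∫ h in Ioc 0 (2 * R), ∫ t : ℝ, φ t * φ (t + h) * ‖w (t + h) - w t‖ ^ 2 := by
  obtain ⟨F, hF⟩ : ∃ F : ℝ → ℝ → ℝ, F = fun h t =>
      (Icc (-(2 * R)) (2 * R)).indicator (fun _ => (1 : ℝ)) h *
        (φ t * φ (t + h) * ‖w (t + h) - w t‖ ^ 2) := ⟨_, rfl⟩
  have hFi : Integrable (Function.uncurry F) ((volume : Measure ℝ).prod volume) := by
    rw [hF]
    exact doobBP_prod_integrable hφc hwc hR hsupp
  have hF0 : ∀ h t, 0 ≤ F h t := fun h t => by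
    rw [hF]
    exact mul_nonneg (Set.indicator_nonneg (fun _ _ => zero_le_one) _)
      (mul_nonneg (mul_nonneg (hφ0 _) (hφ0 _)) (sq_nonneg _))
  -- the `h`-sections of `F`
  have hrow : ∀ h, (∫ t, F h t) = (Icc (-(2 * R)) (2 * R)).indicator
      (fun h => ∫ t : ℝ, φ t * φ (t + h) * ‖w (t + h) - w t‖ ^ 2) h := by
    intro h
    rw [hF]
    beta_reduce
    rw [integral_const_mul]
    by_cases hh : h ∈ Icc (-(2 * R)) (2 * R) <;> simp [hh]
  have hIint : IntegrableOn (fun h => ∫ t : ℝ, φ t * φ (t + h) * ‖w (t + h) - w t‖ ^ 2)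
      (Icc (-(2 * R)) (2 * R)) :=
    (integrable_indicator_iff measurableSet_Icc).1
      (hFi.integral_prod_left.congr (ae_of_all _ hrow))
  have hA : (∫ h, ∫ t, F h t) =
      ∫ h in Icc (-(2 * R)) (2 * R), ∫ t : ℝ, φ t * φ (t + h) * ‖w (t + h) - w t‖ ^ 2 := by
    rw [← integral_indicator measurableSet_Icc]
    exact integral_congr_ae (ae_of_all _ hrow)
  -- the `t`-sections of `F`
  have hcol : ∀ t, (∫ h, F h t) =
      ∫ s in Icc (t - 2 * R) (t + 2 * R), φ t * φ s * ‖w s - w t‖ ^ 2 := by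
    intro t
    have e1 : (∫ h, F h t) =
        ∫ h in Icc (-(2 * R)) (2 * R), φ t * φ (t + h) * ‖w (t + h) - w t‖ ^ 2 := by
      rw [← integral_indicator measurableSet_Icc, hF]
      refine integral_congr_ae (ae_of_all _ fun h => ?_)
      by_cases hh : h ∈ Icc (-(2 * R)) (2 * R) <;> simp [hh]
    have e2 : ∫ h in (-(2 * R))..(2 * R), φ t * φ (t + h) * ‖w (t + h) - w t‖ ^ 2 =
        ∫ s in (t + -(2 * R))..(t + 2 * R), φ t * φ s * ‖w s - w t‖ ^ 2 :=
      intervalIntegral.integral_comp_add_left (fun s => φ t * φ s * ‖w s - w t‖ ^ 2) t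
    rw [e1, integral_Icc_eq_integral_Ioc, integral_Icc_eq_integral_Ioc,
      ← intervalIntegral.integral_of_le (by linarith : -(2 * R) ≤ 2 * R),
      ← intervalIntegral.integral_of_le (by linarith : t - 2 * R ≤ t + 2 * R), e2,
      ← sub_eq_add_neg]
  -- restriction to the square
  have hD : ∀ t ∈ Icc (-R) R,
      (∫ s in Icc (-R) R, φ t * φ s * ‖w s - w t‖ ^ 2) ≤ ∫ h, F h t := by
    intro t ht
    rw [hcol t]
    exact setIntegral_mono_set
      ((by fun_prop : Continuous fun s => φ t * φ s * ‖w s - w t‖ ^ 2).integrableOn_Icc)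
      (ae_of_all _ fun s => mul_nonneg (mul_nonneg (hφ0 _) (hφ0 _)) (sq_nonneg _))
      (Icc_subset_Icc (by linarith [ht.2]) (by linarith [ht.1])).eventuallyLE
  have hcolInt : Integrable (fun t => ∫ h, F h t) := hFi.integral_prod_right
  calc ∫ t in Icc (-R) R, ∫ s in Icc (-R) R, φ t * φ s * ‖w s - w t‖ ^ 2
      ≤ ∫ t in Icc (-R) R, ∫ h, F h t :=
        integral_mono_of_nonneg
          (ae_of_all _ fun t => integral_nonneg fun s =>
            mul_nonneg (mul_nonneg (hφ0 _) (hφ0 _)) (sq_nonneg _))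
          hcolInt.integrableOn (ae_restrict_of_forall_mem measurableSet_Icc hD)
    _ ≤ ∫ t, ∫ h, F h t :=
        setIntegral_le_integral hcolInt (ae_of_all _ fun t => integral_nonneg fun h => hF0 h t)
    _ = ∫ h in Icc (-(2 * R)) (2 * R), ∫ t : ℝ, φ t * φ (t + h) * ‖w (t + h) - w t‖ ^ 2 := by
        rw [← integral_integral_swap hFi, hA]
    _ = 2 * ∫ h in Ioc 0 (2 * R), ∫ t : ℝ, φ t * φ (t + h) * ‖w (t + h) - w t‖ ^ 2 :=
        doobBP_half (by linarith) (fun h => doobBP_I_even φ w h) hIint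

/-! ## Step 3: the variance identity on the square -/

/-- **Variance identity.** For continuous `φ`, `w` and a centre `c` with
`c · ∫_{[−R,R]} φ = ∫_{[−R,R]} φ w` (so that `∫_{[−R,R]} φ (w − c) = 0`):
`∬_{[−R,R]²} φ(t)φ(s)‖w(s) − w(t)‖² ds dt = 2 (∫_{[−R,R]} φ) ∫_{[−R,R]} φ ‖w − c‖²`. [folklore] -/
theorem doobBP_variance {φ : ℝ → ℝ} (hφc : Continuous φ) {w : ℝ → ℂ} (hwc : Continuous w)
    (R : ℝ) (c : ℂ)
    (hc : c * ((∫ s in Icc (-R) R, φ s : ℝ) : ℂ) = ∫ s in Icc (-R) R, (φ s : ℂ) * w s) :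
    ∫ t in Icc (-R) R, ∫ s in Icc (-R) R, φ t * φ s * ‖w s - w t‖ ^ 2 =
      2 * (∫ s in Icc (-R) R, φ s) * ∫ s in Icc (-R) R, φ s * ‖w s - c‖ ^ 2 := by
  obtain ⟨m, hm⟩ : ∃ m : ℝ, m = ∫ s in Icc (-R) R, φ s := ⟨_, rfl⟩
  obtain ⟨V, hV⟩ : ∃ V : ℝ, V = ∫ s in Icc (-R) R, φ s * ‖w s - c‖ ^ 2 := ⟨_, rfl⟩
  rw [← hm] at hc ⊢
  rw [← hV]
  -- `∫ φ (w − c) = 0`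
  have hZ : ∫ s in Icc (-R) R, (φ s : ℂ) * (w s - c) = 0 := by
    have i1 : IntegrableOn (fun s => (φ s : ℂ) * w s) (Icc (-R) R) :=
      (by fun_prop : Continuous fun s => (φ s : ℂ) * w s).integrableOn_Icc
    have i2 : IntegrableOn (fun s => (φ s : ℂ) * c) (Icc (-R) R) :=
      (by fun_prop : Continuous fun s => (φ s : ℂ) * c).integrableOn_Icc
    simp_rw [mul_sub]
    rw [integral_sub i1 i2, integral_mul_const, integral_complex_ofReal, ← hm, ← hc]
    ring
  -- the inner integral
  have hinner : ∀ t, ∫ s in Icc (-R) R, φ t * φ s * ‖w s - w t‖ ^ 2 =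
      φ t * V + φ t * ‖w t - c‖ ^ 2 * m := by
    intro t
    have i1 : IntegrableOn (fun s => φ t * (φ s * ‖w s - c‖ ^ 2)) (Icc (-R) R) :=
      (by fun_prop : Continuous fun s => φ t * (φ s * ‖w s - c‖ ^ 2)).integrableOn_Icc
    have i2 : IntegrableOn (fun s => φ t * ‖w t - c‖ ^ 2 * φ s) (Icc (-R) R) :=
      (by fun_prop : Continuous fun s => φ t * ‖w t - c‖ ^ 2 * φ s).integrableOn_Icc
    have iZ : IntegrableOn (fun s => (φ s : ℂ) * (w s - c) * conj (w t - c)) (Icc (-R) R) :=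
      (by fun_prop : Continuous fun s => (φ s : ℂ) * (w s - c) * conj (w t - c)).integrableOn_Icc
    have i3 : IntegrableOn (fun s => 2 * φ t * ((φ s : ℂ) * (w s - c) * conj (w t - c)).re)
        (Icc (-R) R) := by
      have := (Integrable.re iZ).const_mul (2 * φ t)
      simp only [RCLike.re_to_complex] at this
      exact this
    have hcross : ∫ s in Icc (-R) R, ((φ s : ℂ) * (w s - c) * conj (w t - c)).re = 0 := by
      have e := integral_re iZ
      simp only [RCLike.re_to_complex] at e
      rw [e, integral_mul_const, hZ, zero_mul, Complex.zero_re]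
    refine (setIntegral_congr_fun measurableSet_Icc
      fun s _ => doobBP_polar c (φ t) (φ s) (w s) (w t)).trans ?_
    rw [integral_sub (i1.fun_add i2) i3, integral_add i1 i2, integral_const_mul,
      integral_const_mul, integral_const_mul, hcross, ← hV, ← hm]
    ring
  rw [setIntegral_congr_fun measurableSet_Icc fun t _ => hinner t]
  have i4 : IntegrableOn (fun t => φ t * V) (Icc (-R) R) :=
    (hφc.mul continuous_const).integrableOn_Icc
  have i5 : IntegrableOn (fun t => φ t * ‖w t - c‖ ^ 2 * m) (Icc (-R) R) :=
    (by fun_prop : Continuous fun t => φ t * ‖w t - c‖ ^ 2 * m).integrableOn_Icc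
  rw [integral_add i4 i5, integral_mul_const, integral_mul_const, ← hm, ← hV]
  ring

/-! ## Step 1 and assembly for a general positive continuous weight -/

/-- **Bulk Poincaré inequality, general weight.** For a continuous weight `φ > 0`, a continuous
`w` with `tsupport w ⊆ [−R, R]`, `0 < R ≤ 1/8`, and `J · I` integrable on `(0, 2R]`
(`J(h) = e^{h/2}/(2 sinh h) − 2cosh(h/2)`, `I(h) = ∫ φ(t)φ(t+h)‖w(t+h) − w(t)‖² dt`):
`J(2R) · m · ∫_{[−R,R]} φ‖w − w̄‖² ≤ ∫_{(0,2R]} J I`, `m = ∫_{[−R,R]} φ`, `w̄ = (∫_{[−R,R]} φ w)/m`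
(`J ≥ J(2R) > 0` on `(0, 2R]` by `doobLR_partB` and `stub_doobKernel_sign`; then
`doobBP_square_le` and `doobBP_variance`). [folklore] -/
theorem doobBP_main {φ : ℝ → ℝ} (hφc : Continuous φ) (hφpos : ∀ t, 0 < φ t) {w : ℝ → ℂ}
    (hwc : Continuous w) {R : ℝ} (hR : 0 < R) (hR8 : R ≤ 1 / 8)
    (hsupp : tsupport w ⊆ Icc (-R) R)
    (hJI : IntegrableOn (fun h : ℝ =>
      (Real.exp (h / 2) / (2 * Real.sinh h) - 2 * Real.cosh (h / 2)) *
        ∫ t : ℝ, φ t * φ (t + h) * ‖w (t + h) - w t‖ ^ 2) (Ioc 0 (2 * R))) :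
    (Real.exp (2 * R / 2) / (2 * Real.sinh (2 * R)) - 2 * Real.cosh (2 * R / 2)) *
        (∫ s in Icc (-R) R, φ s) *
        (∫ s in Icc (-R) R, φ s *
          ‖w s - (∫ t in Icc (-R) R, (φ t : ℂ) * w t) / ((∫ t in Icc (-R) R, φ t : ℝ) : ℂ)‖ ^ 2) ≤
      ∫ h in Ioc 0 (2 * R), (Real.exp (h / 2) / (2 * Real.sinh h) - 2 * Real.cosh (h / 2)) *
        ∫ t : ℝ, φ t * φ (t + h) * ‖w (t + h) - w t‖ ^ 2 := by
  have hφ0 : ∀ t, 0 ≤ φ t := fun t => (hφpos t).le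
  have h2R : 0 < 2 * R := by positivity
  have hJ0 : 0 < Real.exp (2 * R / 2) / (2 * Real.sinh (2 * R)) - 2 * Real.cosh (2 * R / 2) :=
    sub_pos.2 (stub_doobKernel_sign.1 (2 * R) h2R (by linarith))
  -- `m > 0`
  have hm : 0 < ∫ s in Icc (-R) R, φ s := by
    rw [integral_Icc_eq_integral_Ioc, ← intervalIntegral.integral_of_le (by linarith : -R ≤ R)]
    exact intervalIntegral.intervalIntegral_pos_of_pos_on (hφc.intervalIntegrable _ _)
      (fun x _ => hφpos x) (by linarith)
  -- steps 2 and 3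
  have hvar := doobBP_variance hφc hwc R
    ((∫ t in Icc (-R) R, (φ t : ℂ) * w t) / ((∫ t in Icc (-R) R, φ t : ℝ) : ℂ))
    (div_mul_cancel₀ _ (Complex.ofReal_ne_zero.2 hm.ne'))
  have hsq := doobBP_square_le hφc hφ0 hwc hR.le hsupp
  rw [hvar] at hsq
  -- step 1
  have hstep1 : (Real.exp (2 * R / 2) / (2 * Real.sinh (2 * R)) - 2 * Real.cosh (2 * R / 2)) *
      (∫ h in Ioc 0 (2 * R), ∫ t : ℝ, φ t * φ (t + h) * ‖w (t + h) - w t‖ ^ 2) ≤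
      ∫ h in Ioc 0 (2 * R), (Real.exp (h / 2) / (2 * Real.sinh h) - 2 * Real.cosh (h / 2)) *
        ∫ t : ℝ, φ t * φ (t + h) * ‖w (t + h) - w t‖ ^ 2 := by
    rw [← integral_const_mul]
    refine integral_mono_of_nonneg
      (ae_of_all _ fun h => mul_nonneg hJ0.le (doobBP_I_nonneg hφ0 w h)) hJI
      (ae_restrict_of_forall_mem measurableSet_Ioc fun h hh => ?_)
    exact mul_le_mul_of_nonneg_right (doobLR_partB hh.1 h2R hh.2) (doobBP_I_nonneg hφ0 w h)
  have key := mul_le_mul_of_nonneg_left hsq hJ0.le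
  linarith

/-! ## The registered stub -/

/-- **Stub G3 — `doob_bulkPoincare` (RH-free; card `xi-kernel-doob-transform` F1).**  On an inner
window `[−R, R]`, `R ≤ 1/8`, every lag `h ≤ 2R ≤ 1/4` has positive kernel `J(h) ≥ J(2R) > 0`
(`stub_doobKernel_sign`, antitonicity `doobLR_partB`), and the short-range Doob energy controls the
`Φ`-weighted variance: `J(2R) · m_R · ∫_{[−R,R]} Φ‖w − w̄‖² ≤ ∫_{(0,2R]} J(h) I_w(h) dh`,
`m_R = ∫_{[−R,R]} Φ`, `w̄ = (∫_{[−R,R]} Φ w)/m_R`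
(`∫₀^{2R} I_w ≥ ½∬_{[−R,R]²} Φ(s)Φ(t)‖w(s)−w(t)‖² = m_R ∫Φ‖w−w̄‖²`; integrability of `J · I_w` on
`(0, 2R]` from `stub_doob_arch` and `stub_doob_polar`). [folklore] -/
theorem stub_doob_bulkPoincare :
    ∀ (w : ℝ → ℂ) (R : ℝ), IsWeilTest w → 0 < R → R ≤ 1 / 8 → tsupport w ⊆ Icc (-R) R →
      (Real.exp (2 * R / 2) / (2 * Real.sinh (2 * R)) - 2 * Real.cosh (2 * R / 2)) *
          (∫ s in Icc (-R) R, 2 * LagariasMontague.Psi (2 * s)) *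
          (∫ s in Icc (-R) R, 2 * LagariasMontague.Psi (2 * s) *
            ‖w s - (∫ t in Icc (-R) R, ((2 * LagariasMontague.Psi (2 * t) : ℝ) : ℂ) * w t) /
              ((∫ t in Icc (-R) R, 2 * LagariasMontague.Psi (2 * t) : ℝ) : ℂ)‖ ^ 2) ≤
        ∫ h in Ioc 0 (2 * R), (Real.exp (h / 2) / (2 * Real.sinh h) - 2 * Real.cosh (h / 2)) *
          ∫ t : ℝ, 2 * LagariasMontague.Psi (2 * t) * (2 * LagariasMontague.Psi (2 * (t + h))) *
            ‖w (t + h) - w t‖ ^ 2 := by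
  intro w R hw hR hR8 hsupp
  have hφc : Continuous fun t : ℝ => 2 * LagariasMontague.Psi (2 * t) :=
    continuous_const.mul ((LagariasMontague.continuous_thetaSeries _).comp
      (continuous_const.mul continuous_id))
  have hφpos : ∀ t : ℝ, 0 < 2 * LagariasMontague.Psi (2 * t) := fun t =>
    mul_pos two_pos (geDoob_Psi_pos _)
  have hJI : IntegrableOn (fun h : ℝ =>
      (Real.exp (h / 2) / (2 * Real.sinh h) - 2 * Real.cosh (h / 2)) *
        ∫ t : ℝ, 2 * LagariasMontague.Psi (2 * t) * (2 * LagariasMontague.Psi (2 * (t + h))) *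
          ‖w (t + h) - w t‖ ^ 2) (Ioc 0 (2 * R)) := by
    have h1 := (stub_doob_arch w hw).1.mono_set (fun x (hx : x ∈ Ioc (0 : ℝ) (2 * R)) => hx.1)
    have h2 := (((stub_doob_polar.2.2 w hw).1.const_mul 2).integrableOn (s := Ioc (0 : ℝ) (2 * R)))
    refine (Integrable.sub h1 h2).congr (ae_of_all _ fun h => ?_)
    simp only [Pi.sub_apply]
    ring
  have main := doobBP_main hφc hφpos hw.1.continuous hR hR8 hsupp hJI
  beta_reduce at main
  exact main

end Summit.RiemannHypothesis.RiemannHypothesis.Theorems.GroundStatesConvergeToXi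

end
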